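import Literature.Geometry.ComplexHyperbolic.UnitBallU21Borel      -- `U21`, `mat`, `J`, the Borel structure on `U(2,1)`
import Literature.Geometry.ComplexHyperbolic.UnitBallBounds        -- `mat_inv`, entry facts
import HarnessLib

/-!
# Harish-Chandra's invariant integral on the LIE ALGEBRA `𝔲(2,1)` — the currency of ROAD «A6-IV» (definitions)
# (Warner, *Harmonic Analysis on Semi-Simple Lie Groups II* §8.4.1, §8.4.3; Harish-Chandra 1957 «Differential operators on a semisimple Lie algebra», «Fourier transforms on a semisimple Lie algebra I»)

Topic `Geometry/ComplexHyperbolic`; namespace `Literature.Geometry.ComplexHyperbolic.BallModel`.  DEFINITIONS (review lane) + `rfl`∕`simp` plumbing; no instance, no notation, no axiom, no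
named fact, no `sorry`.  Cell `pub/hodgecm-mathlib`, ENGINE T1 (crux H413 = `stmt-HodgeConjecture-24833`); ROAD A (N1 = `stub_L21`, print row #179 (A6)∕(A6′)), design of record
`DESIGN-A6-InHouse-v2-ArchitectureIV` 93542b84 (LEAD T11-4): Harish-Chandra's bootstrap for BOUNDED FOURTH JETS of `F_Θ∘chart` on every chamber runs on the LIE ALGEBRA.  This file fixes the ONE
currency every brick (a1)(a2)(b1)(b3)(c3′)(d2)(f1) types against; author F0P3a-p05 (g15) (ROAD A owner), 2026-09-01.

THE OBJECTS (`G = U(2,1)` in the ball model, `J = diag(1,1,−1)`; `𝔤 = 𝔲(2,1) = {X ∈ M₃(ℂ) | Xᴴ J + J X = 0}`, a 9-dimensional REAL subspace of `M₃(ℂ) ≅ ℝ¹⁸`; test functions are AMBIENT,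
`f : M₃(ℂ) → E`, exactly as the group-side `Θ` of ★ ROAD A files — no Lie-algebra TYPE is introduced):
* `torusH θ = diag(iθ₀, iθ₁, iθ₂)` — the compact Cartan subalgebra `𝔧 = 𝔱` in angle coordinates (`exp(torusH θ) = diag(e^{iθ_k})` = the chart of ★ `ArchCentralLimitAngleChart` at `ζ = 1`);
* `rootProduct θ = (θ₀−θ₁)(θ₀−θ₂)(θ₁−θ₂)` — Harish-Chandra's `π = ∏_{α>0} α` on `𝔧` (up to the harmless factor `i³`); `θ₀−θ₁` is the COMPACT root, `θ₀−θ₂`, `θ₁−θ₂` the two NONCOMPACT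
  (= singular imaginary) roots;
* `lieOrbital μ f X = ∫_G f(Ad(g)X) dμ(g)`, `Ad(g)X = mat g · X · mat g⁻¹` — the orbital integral of an ambient `f` at ANY `X ∈ M₃(ℂ)` (used at `X = torusH θ`, `θ` regular);
* `liePhi μ f θ = rootProduct θ • lieOrbital μ f (torusH θ)` — Harish-Chandra's `φ_f = π·Φ_f` in the chart [Warner 8.4.1];
* `lieBasis : Fin 9 → M₃(ℂ)` — a REAL basis of `𝔲(2,1)`, orthogonal for the trace form `B(X,Y) = Re tr(XY)`: `iE₀₀, iE₁₁, iE₂₂` (`B = −1`), the compact root plane `E₀₁−E₁₀, i(E₀₁+E₁₀)`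
  (`B = −2`), the noncompact root planes `E_{p2}+E_{2p}, i(E_{p2}−E_{2p})`, `p = 0,1` (`B = +2`); `lieWeight a = 1∕B(E_a,E_a) ∈ {−1, −½, ½}` — the DUAL-basis coefficients, so that
  `Σ_a lieWeight a • (E_a ⊗ E_a)` is the Casimir tensor of `(𝔤, B)`;
* `lieLaplacian f X = Σ_a lieWeight a • D²f(X)[E_a, E_a]` — HC's `∂(ω)`, the invariant second-order constant-coefficient operator of `B` (directions in `𝔤` only; for ambient `f` this is the
  `𝔤`-partial Laplacian, which is all the orbital integral sees);
* `cubicForm U V W = 3·Im tr(UVW + UWV)` = `D³P₃[U,V,W]` for the cubic invariant `P₃(X) = Im tr(X³)`; `lieCubic f X = Σ_{a,b,c} (w_a w_b w_c · cubicForm(E_a,E_b,E_c)) • D³f(X)[E_a,E_b,E_c]`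
  = HC's `∂(D³P₃)` with indices raised by `B` — by design v2 (★2) it equals `(1∕8)·ad(lieLaplacian)³(P₃·)` (brick (b2)∕(b3) proves that; nothing here depends on it);
* `lieCentral f X = Df(X)[i·1]` — the derivative along the centre `iℝ·1` (HC's `∂(P₁)`, `P₁ = Im tr`);
* `invP₁ X = Im tr X`, `invP₂ X = Re tr(X²)`, `invP₃ X = Im tr(X³)` — the generators of the `Ad`-invariant polynomials restricted from `𝔤𝔩₃` (on `torusH θ`: `Σθ_k`, `−Σθ_k²`, `−Σθ_k³`).
DESIGN CHOICES.  (i) No `Submodule`∕`LieAlgebra` structure: every statement downstream is about ambient smooth `f` and explicit matrices, like the group-side files; (ii) the normal form of second and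
third derivatives is Mathlib's `iteratedFDeriv ℝ n f X ![…]` under `open scoped Matrix.Norms.Operator` (the cell's norm on `M₃(ℂ)` — keep it in every consumer so the terms match syntactically);
(iii) signs: `B = Re tr(XY)` is NEGATIVE definite on `𝔨 ⊃ 𝔧` and positive on `𝔭`, so `B|_𝔧 = −Σ dθ_k²` and HC's `∂(ω̄)` in the chart is `−Σ_k ∂²_{θ_k}`; the bricks state their identities with the
constants they find — the bootstrap (d2) only needs SOME non-degenerate `S₃`-invariant constant-coefficient system.
HONEST LABEL: HC_CM is proved only modulo the printed citations until rung 0 closes; these are definitions, they pay nothing.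

## References
* [WarnerHASSLG2] G. Warner, *Harmonic Analysis on Semi-Simple Lie Groups II*, Grundlehren 189 (1972), §8.4.1 (the invariant integral `φ_f` on `𝔧′`), §8.4.3 (Thm. 8.4.3.1), §8.5.1.
* [Rogawski1990] J. D. Rogawski, *Automorphic Representations of Unitary Groups in Three Variables*, Ann. of Math. Stud. 123 (1990), §8.4 pp. 126–127.
* [Helgason2000] S. Helgason, *Groups and Geometric Analysis* (2000), Ch. II §5 (radial part of the Laplacian on `𝔤`: `Δ(Ad) = π⁻¹ L_𝔧 ∘ π`).
-/

set_option autoImplicit false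

noncomputable section

open Matrix Complex ComplexConjugate MeasureTheory

open scoped Matrix.Norms.Operator

namespace Literature.Geometry.ComplexHyperbolic

namespace BallModel

/-! ## §1 The compact Cartan subalgebra in angle coordinates and Harish-Chandra's `π` -/

section Torus

/-- The compact Cartan subalgebra `𝔧 = 𝔱 ⊂ 𝔲(2,1)` in angle coordinates: `torusH θ = diag(iθ₀, iθ₁, iθ₂)` (`exp(torusH θ) = diag(e^{iθ_k})`). [cite: WarnerHASSLG2, §8.4.1] -/
def torusH (θ : Fin 3 → ℝ) : Matrix (Fin 3) (Fin 3) ℂ :=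
  Matrix.diagonal fun k => ((θ k : ℝ) : ℂ) * I

/-- Harish-Chandra's `π = ∏_{α>0} α` on `𝔧` in angle coordinates (factor `i³` dropped): `(θ₀−θ₁)(θ₀−θ₂)(θ₁−θ₂)`; `θ₀−θ₁` compact, `θ₀−θ₂`, `θ₁−θ₂` noncompact roots. [cite: WarnerHASSLG2, §8.4.1] -/
def rootProduct (θ : Fin 3 → ℝ) : ℝ :=
  (θ 0 - θ 1) * (θ 0 - θ 2) * (θ 1 - θ 2)

/-- `torusH` is additive. [cite: WarnerHASSLG2, §8.4.1] -/
theorem torusH_add (θ θ' : Fin 3 → ℝ) : torusH (θ + θ') = torusH θ + torusH θ' := by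
  ext i j
  simp only [torusH, Matrix.add_apply, Matrix.diagonal_apply, Pi.add_apply]
  split_ifs <;> push_cast <;> ring

/-- `torusH` is homogeneous. [cite: WarnerHASSLG2, §8.4.1] -/
theorem torusH_smul (c : ℝ) (θ : Fin 3 → ℝ) : torusH (c • θ) = (c : ℂ) • torusH θ := by
  ext i j
  simp only [torusH, Matrix.smul_apply, Matrix.diagonal_apply, Pi.smul_apply, smul_eq_mul]
  split_ifs <;> push_cast <;> ring

/-- The centre direction: `torusH (fun _ => c) = (c·i) • 1`. [cite: WarnerHASSLG2, §8.4.1] -/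
theorem torusH_const (c : ℝ) : torusH (fun _ : Fin 3 => c) = ((c : ℂ) * I) • (1 : Matrix (Fin 3) (Fin 3) ℂ) := by
  ext i j
  simp only [torusH, Matrix.smul_apply, Matrix.diagonal_apply, Matrix.one_apply, smul_eq_mul]
  split_ifs <;> simp

/-- `torusH θ` lies in `𝔲(2,1)`: `(torusH θ)ᴴ J + J (torusH θ) = 0`. [cite: WarnerHASSLG2, §8.4.1] -/
theorem torusH_conjTranspose_mul_J_add (θ : Fin 3 → ℝ) : (torusH θ)ᴴ * J + J * torusH θ = 0 := by
  ext i j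
  fin_cases i <;> fin_cases j <;> simp [torusH, J, Matrix.mul_apply, Matrix.diagonal, Complex.conj_ofReal]

/-- `π` is translation-invariant along the centre direction `(1,1,1)`. [cite: WarnerHASSLG2, §8.4.1] -/
theorem rootProduct_add_const (θ : Fin 3 → ℝ) (c : ℝ) : rootProduct (θ + fun _ => c) = rootProduct θ := by
  simp only [rootProduct, Pi.add_apply]
  ring

/-- `π ≠ 0` exactly off the three walls. [cite: WarnerHASSLG2, §8.4.1] -/
theorem rootProduct_ne_zero_iff (θ : Fin 3 → ℝ) : rootProduct θ ≠ 0 ↔ θ 0 ≠ θ 1 ∧ θ 0 ≠ θ 2 ∧ θ 1 ≠ θ 2 := by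
  simp only [rootProduct, mul_ne_zero_iff, sub_ne_zero]
  tauto

end Torus

/-! ## §2 The invariant integral on the Lie algebra -/

section Orbital

variable {E : Type*} [NormedAddCommGroup E] [NormedSpace ℝ E]

/-- **THE ORBITAL INTEGRAL ON THE LIE ALGEBRA**: `lieOrbital μ f X = ∫_G f(mat g · X · mat g⁻¹) dμ(g)` for an ambient test function `f : M₃(ℂ) → E` and ANY `X ∈ M₃(ℂ)` (used at `X = torusH θ`, `θ` regular, where
the integrand has compact support in `g` for compactly supported `f`; elsewhere it is whatever Bochner integration returns). [cite: WarnerHASSLG2, §8.4.1] -/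
def lieOrbital (μ : Measure U21) (f : Matrix (Fin 3) (Fin 3) ℂ → E) (X : Matrix (Fin 3) (Fin 3) ℂ) : E :=
  ∫ g, f (mat g * X * mat g⁻¹) ∂μ

/-- **HARISH-CHANDRA's `φ_f` IN THE CHART**: `liePhi μ f θ = π(θ) • ∫_G f(Ad(g)·torusH θ) dμ`. [cite: WarnerHASSLG2, §8.4.1] -/
def liePhi (μ : Measure U21) (f : Matrix (Fin 3) (Fin 3) ℂ → E) (θ : Fin 3 → ℝ) : E :=
  rootProduct θ • lieOrbital μ f (torusH θ)

/-- Unfolding lemma. [cite: WarnerHASSLG2, §8.4.1] -/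
theorem lieOrbital_def (μ : Measure U21) (f : Matrix (Fin 3) (Fin 3) ℂ → E) (X : Matrix (Fin 3) (Fin 3) ℂ) :
    lieOrbital μ f X = ∫ g, f (mat g * X * mat g⁻¹) ∂μ := rfl

/-- Unfolding lemma. [cite: WarnerHASSLG2, §8.4.1] -/
theorem liePhi_def (μ : Measure U21) (f : Matrix (Fin 3) (Fin 3) ℂ → E) (θ : Fin 3 → ℝ) :
    liePhi μ f θ = rootProduct θ • lieOrbital μ f (torusH θ) := rfl

end Orbital

/-! ## §3 The trace form, a `B`-orthogonal basis of `𝔲(2,1)`, and the invariant operators -/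

section Operators

variable {E : Type*} [NormedAddCommGroup E] [NormedSpace ℝ E]

/-- **A REAL BASIS OF `𝔲(2,1)`, ORTHOGONAL FOR `B(X,Y) = Re tr(XY)`**: `iE₀₀, iE₁₁, iE₂₂; E₀₁−E₁₀, i(E₀₁+E₁₀); E₀₂+E₂₀, i(E₀₂−E₂₀); E₁₂+E₂₁, i(E₁₂−E₂₁)` (torus; compact root plane;
the two noncompact root planes). [cite: WarnerHASSLG2, §8.4.3] -/
def lieBasis : Fin 9 → Matrix (Fin 3) (Fin 3) ℂ :=
  ![I • Matrix.single 0 0 1, I • Matrix.single 1 1 1, I • Matrix.single 2 2 1,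
    Matrix.single 0 1 1 - Matrix.single 1 0 1, I • (Matrix.single 0 1 1 + Matrix.single 1 0 1),
    Matrix.single 0 2 1 + Matrix.single 2 0 1, I • (Matrix.single 0 2 1 - Matrix.single 2 0 1),
    Matrix.single 1 2 1 + Matrix.single 2 1 1, I • (Matrix.single 1 2 1 - Matrix.single 2 1 1)]

/-- **THE DUAL-BASIS COEFFICIENTS `1∕B(E_a,E_a)`**: `−1` on the torus, `−½` on the compact root plane, `+½` on the noncompact root planes (`B` is negative on `𝔨`, positive on `𝔭`).
[cite: WarnerHASSLG2, §8.4.3] -/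
def lieWeight : Fin 9 → ℝ :=
  ![-1, -1, -1, -1 / 2, -1 / 2, 1 / 2, 1 / 2, 1 / 2, 1 / 2]

/-- **HARISH-CHANDRA's `∂(ω)` ON `𝔤`** for an ambient `f`: `lieLaplacian f X = Σ_a lieWeight a • D²f(X)[E_a, E_a]` — the `B`-Laplacian in the `𝔤`-directions (Casimir tensor `Σ_a w_a E_a ⊗ E_a`).
[cite: WarnerHASSLG2, §8.4.1] [cite: Helgason2000, Ch. II §5] -/
def lieLaplacian (f : Matrix (Fin 3) (Fin 3) ℂ → E) (X : Matrix (Fin 3) (Fin 3) ℂ) : E :=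
  ∑ a : Fin 9, lieWeight a • iteratedFDeriv ℝ 2 f X ![lieBasis a, lieBasis a]

/-- The polarised cubic invariant: `cubicForm U V W = 3·Im tr(UVW + UWV) = D³P₃[U,V,W]`, `P₃(X) = Im tr(X³)`. [cite: WarnerHASSLG2, §8.4.3] -/
def cubicForm (U V W : Matrix (Fin 3) (Fin 3) ℂ) : ℝ :=
  3 * (Matrix.trace (U * V * W + U * W * V)).im

/-- **HARISH-CHANDRA's CUBIC OPERATOR `∂(D³P₃)` ON `𝔤`** (indices raised by `B`): `lieCubic f X = Σ_{a,b,c} (w_a w_b w_c · cubicForm(E_a,E_b,E_c)) • D³f(X)[E_a,E_b,E_c]`; by design v2 (★2)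
`= (1∕8)·ad(lieLaplacian)³(P₃·)`. [cite: WarnerHASSLG2, §8.4.3] -/
def lieCubic (f : Matrix (Fin 3) (Fin 3) ℂ → E) (X : Matrix (Fin 3) (Fin 3) ℂ) : E :=
  ∑ a : Fin 9, ∑ b : Fin 9, ∑ c : Fin 9,
    (lieWeight a * lieWeight b * lieWeight c * cubicForm (lieBasis a) (lieBasis b) (lieBasis c)) • iteratedFDeriv ℝ 3 f X ![lieBasis a, lieBasis b, lieBasis c]

/-- **THE CENTRAL DERIVATIVE `∂(P₁)`**: `lieCentral f X = Df(X)[i·1]`. [cite: WarnerHASSLG2, §8.4.1] -/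
def lieCentral (f : Matrix (Fin 3) (Fin 3) ℂ → E) (X : Matrix (Fin 3) (Fin 3) ℂ) : E :=
  fderiv ℝ f X (I • (1 : Matrix (Fin 3) (Fin 3) ℂ))

/-- The linear invariant `P₁ = Im tr`. [cite: WarnerHASSLG2, §8.4.3] -/
def invP₁ (X : Matrix (Fin 3) (Fin 3) ℂ) : ℝ := (Matrix.trace X).im

/-- The quadratic invariant `P₂ = Re tr(X²)` (`= B(X,X)`). [cite: WarnerHASSLG2, §8.4.3] -/
def invP₂ (X : Matrix (Fin 3) (Fin 3) ℂ) : ℝ := (Matrix.trace (X * X)).re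

/-- The cubic invariant `P₃ = Im tr(X³)`. [cite: WarnerHASSLG2, §8.4.3] -/
def invP₃ (X : Matrix (Fin 3) (Fin 3) ℂ) : ℝ := (Matrix.trace (X * X * X)).im

/-- Unfolding lemma. [cite: WarnerHASSLG2, §8.4.1] -/
theorem lieLaplacian_def (f : Matrix (Fin 3) (Fin 3) ℂ → E) (X : Matrix (Fin 3) (Fin 3) ℂ) :
    lieLaplacian f X = ∑ a : Fin 9, lieWeight a • iteratedFDeriv ℝ 2 f X ![lieBasis a, lieBasis a] := rfl

/-- Unfolding lemma. [cite: WarnerHASSLG2, §8.4.3] -/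
theorem lieCubic_def (f : Matrix (Fin 3) (Fin 3) ℂ → E) (X : Matrix (Fin 3) (Fin 3) ℂ) :
    lieCubic f X = ∑ a : Fin 9, ∑ b : Fin 9, ∑ c : Fin 9,
      (lieWeight a * lieWeight b * lieWeight c * cubicForm (lieBasis a) (lieBasis b) (lieBasis c)) • iteratedFDeriv ℝ 3 f X ![lieBasis a, lieBasis b, lieBasis c] := rfl

/-- Unfolding lemma. [cite: WarnerHASSLG2, §8.4.1] -/
theorem lieCentral_def (f : Matrix (Fin 3) (Fin 3) ℂ → E) (X : Matrix (Fin 3) (Fin 3) ℂ) :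
    lieCentral f X = fderiv ℝ f X (I • (1 : Matrix (Fin 3) (Fin 3) ℂ)) := rfl

end Operators

/-! ## §4 `Ad`-invariance of the generators `P₁, P₂, P₃` and their values on the torus -/

section Invariants

/-- `P₁` is `Ad`-invariant: `Im tr(g X g⁻¹) = Im tr X`. [cite: WarnerHASSLG2, §8.4.3] -/
theorem invP₁_conj (g : U21) (X : Matrix (Fin 3) (Fin 3) ℂ) : invP₁ (mat g * X * mat g⁻¹) = invP₁ X := by
  unfold invP₁
  rw [Matrix.trace_mul_cycle, ← mat_mul, inv_mul_cancel, mat_one, Matrix.one_mul]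

/-- `P₂` is `Ad`-invariant. [cite: WarnerHASSLG2, §8.4.3] -/
theorem invP₂_conj (g : U21) (X : Matrix (Fin 3) (Fin 3) ℂ) : invP₂ (mat g * X * mat g⁻¹) = invP₂ X := by
  unfold invP₂
  have h : mat g * X * mat g⁻¹ * (mat g * X * mat g⁻¹) = mat g * (X * X) * mat g⁻¹ := by
    rw [show mat g * X * mat g⁻¹ * (mat g * X * mat g⁻¹) = mat g * X * (mat g⁻¹ * mat g) * X * mat g⁻¹ by simp only [Matrix.mul_assoc],
      ← mat_mul, inv_mul_cancel, mat_one, Matrix.mul_one]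
    simp only [Matrix.mul_assoc]
  rw [h, Matrix.trace_mul_cycle, ← mat_mul, inv_mul_cancel, mat_one, Matrix.one_mul]

/-- `P₃` is `Ad`-invariant. [cite: WarnerHASSLG2, §8.4.3] -/
theorem invP₃_conj (g : U21) (X : Matrix (Fin 3) (Fin 3) ℂ) : invP₃ (mat g * X * mat g⁻¹) = invP₃ X := by
  unfold invP₃
  have hgg : mat g⁻¹ * mat g = 1 := by rw [← mat_mul, inv_mul_cancel, mat_one]
  have h : mat g * X * mat g⁻¹ * (mat g * X * mat g⁻¹) * (mat g * X * mat g⁻¹) = mat g * (X * X * X) * mat g⁻¹ := by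
    calc mat g * X * mat g⁻¹ * (mat g * X * mat g⁻¹) * (mat g * X * mat g⁻¹)
        = mat g * X * (mat g⁻¹ * mat g) * X * (mat g⁻¹ * mat g) * X * mat g⁻¹ := by simp only [Matrix.mul_assoc]
      _ = mat g * (X * X * X) * mat g⁻¹ := by rw [hgg]; simp only [Matrix.mul_one, Matrix.mul_assoc]
  rw [h, Matrix.trace_mul_cycle, hgg, Matrix.one_mul]

/-- On the torus: `P₁(torusH θ) = θ₀ + θ₁ + θ₂`. [cite: WarnerHASSLG2, §8.4.3] -/
theorem invP₁_torusH (θ : Fin 3 → ℝ) : invP₁ (torusH θ) = θ 0 + θ 1 + θ 2 := by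
  simp [invP₁, torusH, Matrix.trace, Fin.sum_univ_three, Matrix.diagonal]

/-- On the torus: `P₂(torusH θ) = −(θ₀² + θ₁² + θ₂²)`. [cite: WarnerHASSLG2, §8.4.3] -/
theorem invP₂_torusH (θ : Fin 3 → ℝ) : invP₂ (torusH θ) = -(θ 0 ^ 2 + θ 1 ^ 2 + θ 2 ^ 2) := by
  simp [invP₂, torusH, Matrix.trace, Fin.sum_univ_three, Matrix.diagonal, Matrix.mul_apply, sq]
  ring

/-- On the torus: `P₃(torusH θ) = −(θ₀³ + θ₁³ + θ₂³)`. [cite: WarnerHASSLG2, §8.4.3] -/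
theorem invP₃_torusH (θ : Fin 3 → ℝ) : invP₃ (torusH θ) = -(θ 0 ^ 3 + θ 1 ^ 3 + θ 2 ^ 3) := by
  simp [invP₃, torusH, Matrix.trace, Fin.sum_univ_three, Matrix.diagonal, Matrix.mul_apply, pow_three]
  ring

end Invariants

/-! ## §5 `Ad`-invariance of the orbital integral and of multiplication by invariants -/

section OrbitalInvariance

variable {E : Type*} [NormedAddCommGroup E] [NormedSpace ℝ E]

/-- **`Ad`-INVARIANCE OF THE ORBITAL INTEGRAL**: for a right-invariant measure, `lieOrbital μ f (mat h · X · mat h⁻¹) = lieOrbital μ f X`. [cite: WarnerHASSLG2, §8.4.1] -/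
theorem lieOrbital_conj (μ : Measure U21) [μ.IsMulRightInvariant] (f : Matrix (Fin 3) (Fin 3) ℂ → E) (h : U21) (X : Matrix (Fin 3) (Fin 3) ℂ) :
    lieOrbital μ f (mat h * X * mat h⁻¹) = lieOrbital μ f X := by
  unfold lieOrbital
  have hmul : ∀ g : U21, mat g * (mat h * X * mat h⁻¹) * mat g⁻¹ = mat (g * h) * X * mat (g * h)⁻¹ := by
    intro g
    rw [_root_.mul_inv_rev, mat_mul, mat_mul]
    simp only [Matrix.mul_assoc]
  simp_rw [hmul]
  exact integral_mul_right_eq_self (fun g => f (mat g * X * mat g⁻¹)) h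

/-- **MULTIPLICATION BY AN INVARIANT PASSES THROUGH**: if `P(mat g · Y · mat g⁻¹) = P Y` for all `g, Y`, then `lieOrbital μ (fun Y => P Y • f Y) X = P X • lieOrbital μ f X` (HC's `R(P) = p̄`).
[cite: WarnerHASSLG2, §8.4.1] -/
theorem lieOrbital_invariant_smul (μ : Measure U21) (f : Matrix (Fin 3) (Fin 3) ℂ → E) (P : Matrix (Fin 3) (Fin 3) ℂ → ℝ)
    (hP : ∀ (g : U21) (Y : Matrix (Fin 3) (Fin 3) ℂ), P (mat g * Y * mat g⁻¹) = P Y) (X : Matrix (Fin 3) (Fin 3) ℂ) :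
    lieOrbital μ (fun Y => P Y • f Y) X = P X • lieOrbital μ f X := by
  unfold lieOrbital
  simp_rw [hP]
  exact integral_smul _ _

end OrbitalInvariance

end BallModel

end Literature.Geometry.ComplexHyperbolic

end
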